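import Summits.ABC.IUTFork.Conditional.InhUniformBandCells
import HarnessLib

/-!
# R-W WINDOW-TABLE, W3 «UNIFORM LEMMA» lane, INHABITED side — the integer cells of `2 + 3¹⁰·109 = 23⁵` for EVERY level `l`
# (row «W:INHABITED-BANDS», abc-iut-plan g10 C-R72; certificate recipe abc-iut-rw-num-lead INHABITED-UNIFORM-CERTS.tsv 572449ea63f1d45c)

PROOF-ONLY file (D-0012; 0 definitions, 0 `Prop` facts; pure integer arithmetic) of the abc-iut cell — D-0079 RESCUE sub-cell R-W
«WINDOW Θ-SIDE INEQUALITY», seat abc-iut-W-num-6 (gen 3). For the known abc triple `2 + 3¹⁰·109 = 23⁵` (`λ = 2/6436343`) and each odd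
prime `p ∣ abc`: the licence socket's integer cell `e·⌊(j²P − j·D − (j+1)·ρin)/e⌋ + (j+1)·ρout ≤ P` (abc-iut-w4-d036 p460046/p460573,
orders form `Cor312Prov.licence_settingPrVolSharp_pilotDataOfK_of_orders_rat` of abc-iut-W-row-1; `P = e·2v_p(abc)/(2l)`) at EVERY label
`j ≤ (l−1)/2`, for EVERY level `l ≥ L₀(p)` and EVERY ramification index of the kernel's divisibility class `e = E₀(p)·l·m`, `m ≥ 1`
(`l ∣ e` abc-iut-W-neg-1 `GenuineK.prime_dvd_absRamificationIdx_kOf_ratPoint`; `15·l ∣ e·v_p` Tate root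
`GenuineK.fifteen_mul_prime_dvd_absRamificationIdx_kOf_mul_ratPoint`; `(p−1) ∣ e` at `p ∣ 30` abc-iut-W-neg-2
`GenuineK.sub_one_dvd_absRamificationIdx_kOf`; `2·l ∣ e`, `30·l ∣ e·v_p` at an ODD pole of `λ` abc-iut-w4-d107
`GenuineK.thirty_mul_prime_dvd_absRamificationIdx_kOf_mul_of_odd_pole`), with the ONE-SIDED data the kernel supplies for every such field:
`D = 2e − 1` at `p ∈ {{3,5}}`, `p ∤ v_p` (abc-iut-W-neg-1 `GenuineK.sub_one_div_le_differentOrd_kOf_wild_ratPoint`) else `D = e − 1`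
([IUTchIV] Prop. 1.3 (i)); `ρin = ⌊e/(p−1)⌋` (abc-iut-c312-5's integer slot, `WRow.inner_witness_slot`) or `1`; `ρout = min(p^a − a·e, p^b − b·e)`
(abc-iut-c312-3's envelope, `WRow.outer_member_min`). METHOD (uniform in `l`, no case split on `l`): drop the floor (`InhBand.cell_of_noFloor` shape),
the floor-free form is a CONVEX quadratic in `j` so its two ends suffice (`InhBand.quad_nonpos_of_ends`), and each end is linear in `m` with
coefficients polynomial (degree ≤ 2) in `l`, nonpositive from `L₀` on (`InhBand.quad_nonpos_from`). Thresholds and coefficients: this seat's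
second engine HOME/abc-iut-W-num-6/inhband/engine.py + emit_cells.py (exact integers; cross-checked against the EXACT cell for `l ≤ 300`,
`m ≤ 3`). Per prime: `p = 23`: `E₀ = 6`, `L₀ = 153`, `a = 2`, slot ρin; `p = 109`: `E₀ = 15`, `L₀ = 5`, `a = 0`. Consumer: `InhUniformBandReyssat.lean` (the datum theorem «S_H INHABITED at EVERY genuine Θ-volume datum over
`(ratPoint λ, l)` for EVERY prime `l ≥ 153`»). HONEST SCOPE: integer arithmetic only; nothing here bears on the printed inequality of
[IUTchIII] Cor. 3.12; inhabited-as-typed ≠ true-in-print; no abc claim. [folklore]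
-/

namespace Summit.ABC.IUTFork.Conditional

/-! ## Over `23` (`v_23(abc) = 5`, `E₀ = 6`, `L₀ = 153`) -/

/-- Floor-free form of the cell over `23` for `reyssat` (`e = 6·l·m`, `P = 30·m`, `D = e − 1`, `ρin = ⌊e/22⌋ (via (p−1)·ρin ≥ e − (p−2))`, `ρout ≤ 23^2 − 2·e`): nonpositive at every label `1 ≤ k+1 ≤ (l−1)/2` for every `l ≥ 153`, `m ≥ 1` — convex in the label, both ends polynomial in `l` and linear in `m`. [folklore] -/
theorem InhBand.poly_reyssat_p23 (k l m : ℤ) (r : ℤ) (hr : (6 * l * m) - 21 ≤ 22 * r) (hl : 153 ≤ l) (hm : 1 ≤ m) (hk : 0 ≤ k) (hkl : 2 * (k + 1) + 1 ≤ l) :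
    (k + 1) ^ 2 * (30 * m) - (k + 1) * (1 * (6 * l * m) - 1) - (k + 2) * r + (k + 2) * ((23 : ℤ) ^ 2 - 2 * (6 * l * m)) ≤ (30 * m) := by
  have hα1 : (-672) * l + (0) ≤ 0 := by linarith
  have hs1 : (-672) * l + (23340) ≤ 0 := by linarith
  have hαM : (-144) * l ^ 2 + (-1596) * l + (-1980) ≤ 0 :=
    InhBand.quad_nonpos_from (-144) (-1596) (-1980) 153 l hl (by norm_num) (by norm_num) (by norm_num)
  have hsM : (-144) * l ^ 2 + (21766) * l + (21294) ≤ 0 :=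
    InhBand.quad_nonpos_from (-144) (21766) (21294) 153 l hl (by norm_num) (by norm_num) (by norm_num)
  have hm0 : 0 ≤ m - 1 := by linarith
  have h1 : (30 * m) + (((23 : ℤ) ^ 2 - 2 * (6 * l * m)) - (1 * (6 * l * m) - 1) - r) + (((23 : ℤ) ^ 2 - 2 * (6 * l * m)) - r - (30 * m)) ≤ 0 := by
    have hid : (22) * (2 * ((23 : ℤ) ^ 2 - 2 * (6 * l * m)) - (1 * (6 * l * m) - 1)) - 2 * ((6 * l * m) - 21) = m * ((-672) * l + (0)) + ((0) * l + (23340)) := by ring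
    have hle : (22) * ((30 * m) + (((23 : ℤ) ^ 2 - 2 * (6 * l * m)) - (1 * (6 * l * m) - 1) - r) + (((23 : ℤ) ^ 2 - 2 * (6 * l * m)) - r - (30 * m))) ≤ (22) * (2 * ((23 : ℤ) ^ 2 - 2 * (6 * l * m)) - (1 * (6 * l * m) - 1)) - 2 * ((6 * l * m) - 21) := by nlinarith
    nlinarith [mul_nonpos_iff.mpr (Or.inl ⟨hm0, hα1⟩)]
  have hM : (30 * m) * (l - 1) ^ 2 + 2 * (((23 : ℤ) ^ 2 - 2 * (6 * l * m)) - (1 * (6 * l * m) - 1) - r) * (l - 1) + 4 * (((23 : ℤ) ^ 2 - 2 * (6 * l * m)) - r - (30 * m)) ≤ 0 := by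
    have hid : (22) * ((30 * m) * (l - 1) ^ 2 + 2 * (((23 : ℤ) ^ 2 - 2 * (6 * l * m)) - (1 * (6 * l * m) - 1)) * (l - 1) + 4 * (((23 : ℤ) ^ 2 - 2 * (6 * l * m)) - (30 * m))) - (2 * (l - 1) + 4) * ((6 * l * m) - 21) =
        m * ((-144) * l ^ 2 + (-1596) * l + (-1980)) + ((0) * l ^ 2 + (23362) * l + (23274)) := by ring
    have hl1 : 0 ≤ 2 * (l - 1) + 4 := by linarith
    have hle : (22) * ((30 * m) * (l - 1) ^ 2 + 2 * (((23 : ℤ) ^ 2 - 2 * (6 * l * m)) - (1 * (6 * l * m) - 1) - r) * (l - 1) + 4 * (((23 : ℤ) ^ 2 - 2 * (6 * l * m)) - r - (30 * m))) ≤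
        (22) * ((30 * m) * (l - 1) ^ 2 + 2 * (((23 : ℤ) ^ 2 - 2 * (6 * l * m)) - (1 * (6 * l * m) - 1)) * (l - 1) + 4 * (((23 : ℤ) ^ 2 - 2 * (6 * l * m)) - (30 * m))) - (2 * (l - 1) + 4) * ((6 * l * m) - 21) := by nlinarith [mul_le_mul_of_nonneg_left hr hl1]
    nlinarith [mul_nonpos_iff.mpr (Or.inl ⟨hm0, hαM⟩)]
  have hA : 0 ≤ (30 * m) := by positivity
  have h := InhBand.quad_nonpos_of_ends (30 * m) (((23 : ℤ) ^ 2 - 2 * (6 * l * m)) - (1 * (6 * l * m) - 1) - r) (((23 : ℤ) ^ 2 - 2 * (6 * l * m)) - r - (30 * m)) (k + 1) l hA (by linarith) (by linarith) hkl h1 hM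
  linarith [h]

/-- **Cells over `23` for `reyssat`, EVERY level `l ≥ 153`, every `e = 6·l·m` (`m ≥ 1`), every label `j = k + 1 ≤ (l−1)/2`**: the socket's integer cell `e·⌊(j²P − j·D − (j+1)·ρin)/e⌋ + (j+1)·ρout ≤ P` with `P = e·10/(2l) = 30·m`, `D = e − 1`, `ρin = ⌊e/22⌋`, `ρout = min(23^2 − 2e, 23^1 − 1e)` (floor dropped, then `InhBand.poly_reyssat_p23`). [folklore] -/
theorem InhBand.cell_reyssat_p23 {l m : ℕ} (hl : 153 ≤ l) (hm : 1 ≤ m) (k : ℕ) (hk : k < (l - 1) / 2) :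
    ((6 * l * m : ℕ) : ℤ) *
          (((((k + 1 : ℕ) : ℤ) ^ 2 * ((6 * l * m * 10 / (2 * l) : ℕ) : ℤ) - ((k + 1 : ℕ) : ℤ) * ((6 * l * m - 1 : ℕ) : ℤ) -
              ((k + 2 : ℕ) : ℤ) * (((6 * l * m / 22 : ℕ) : ℤ)))) / ((6 * l * m : ℕ) : ℤ)) +
        ((k + 2 : ℕ) : ℤ) * min ((23 : ℤ) ^ 2 - 2 * ((6 * l * m : ℕ) : ℤ)) ((23 : ℤ) ^ 1 - 1 * ((6 * l * m : ℕ) : ℤ)) ≤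
      ((6 * l * m * 10 / (2 * l) : ℕ) : ℤ) := by
  have hP : (6 * l * m * 10 / (2 * l) : ℕ) = 30 * m := by
    rw [show 6 * l * m * 10 = 2 * l * (30 * m) by ring]; exact Nat.mul_div_cancel_left _ (by omega)
  have he0 : (0 : ℤ) < ((6 * l * m : ℕ) : ℤ) := by positivity
  have hfloor := Int.mul_ediv_self_le (k := ((6 * l * m : ℕ) : ℤ))
    (x := (((k + 1 : ℕ) : ℤ) ^ 2 * ((6 * l * m * 10 / (2 * l) : ℕ) : ℤ) - ((k + 1 : ℕ) : ℤ) * ((6 * l * m - 1 : ℕ) : ℤ) -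
              ((k + 2 : ℕ) : ℤ) * (((6 * l * m / 22 : ℕ) : ℤ)))) he0.ne'
  have hl0 : 0 < l := by omega
  have hm0 : 0 < m := by omega
  have hsub : ((6 * l * m - 1 : ℕ) : ℤ) = 1 * ((6 * l * m : ℕ) : ℤ) - 1 := by
    rw [Nat.cast_sub (Nat.succ_le_of_lt (by positivity))]; push_cast; ring
  have hmin : min ((23 : ℤ) ^ 2 - 2 * ((6 * l * m : ℕ) : ℤ)) ((23 : ℤ) ^ 1 - 1 * ((6 * l * m : ℕ) : ℤ)) ≤ (23 : ℤ) ^ 2 - 2 * ((6 * l * m : ℕ) : ℤ) := min_le_left _ _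
  have hk2 : (0 : ℤ) ≤ ((k + 2 : ℕ) : ℤ) := by positivity
  have hmin' := mul_le_mul_of_nonneg_left hmin hk2
  have hkl : 2 * ((k : ℤ) + 1) + 1 ≤ (l : ℤ) := by
    have h1 : 2 * (k + 1) + 1 ≤ l := by omega
    exact_mod_cast h1
  have hr : ((6 * l * m : ℕ) : ℤ) - 21 ≤ 22 * (((6 * l * m / 22 : ℕ) : ℤ)) := by
    have h1 := Nat.div_add_mod (6 * l * m) 22
    have h2 := Nat.mod_lt (6 * l * m) (show 0 < 22 by norm_num)
    have h3 : ((6 * l * m : ℕ) : ℤ) = 22 * (((6 * l * m / 22 : ℕ) : ℤ)) + (((6 * l * m % 22 : ℕ) : ℤ)) := by exact_mod_cast h1.symm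
    have h4 : (((6 * l * m % 22 : ℕ) : ℤ)) < 22 := by exact_mod_cast h2
    linarith
  have hpoly := InhBand.poly_reyssat_p23 (k : ℤ) (l : ℤ) (m : ℤ) (((6 * l * m / 22 : ℕ) : ℤ)) (by push_cast at hr ⊢; linarith) (by exact_mod_cast hl) (by exact_mod_cast hm) (by positivity) hkl
  generalize hQ : ((((k + 1 : ℕ) : ℤ) ^ 2 * ((6 * l * m * 10 / (2 * l) : ℕ) : ℤ) - ((k + 1 : ℕ) : ℤ) * ((6 * l * m - 1 : ℕ) : ℤ) -
              ((k + 2 : ℕ) : ℤ) * (((6 * l * m / 22 : ℕ) : ℤ)))) / ((6 * l * m : ℕ) : ℤ) = Q at hfloor ⊢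
  generalize hρ : (((6 * l * m / 22 : ℕ) : ℤ)) = ρ at hfloor hpoly ⊢
  rw [hP, hsub] at hfloor; rw [hP]
  push_cast at hfloor hmin' hpoly ⊢
  linarith [hfloor, hmin', hpoly]

/-! ## Over `109` (`v_109(abc) = 1`, `E₀ = 15`, `L₀ = 5`) -/

/-- Floor-free form of the cell over `109` for `reyssat` (`e = 15·l·m`, `P = 15·m`, `D = e − 1`, `ρin = 1`, `ρout ≤ 109^0 − 0·e`): nonpositive at every label `1 ≤ k+1 ≤ (l−1)/2` for every `l ≥ 5`, `m ≥ 1` — convex in the label, both ends polynomial in `l` and linear in `m`. [folklore] -/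
theorem InhBand.poly_reyssat_p109 (k l m : ℤ) (hl : 5 ≤ l) (hm : 1 ≤ m) (hk : 0 ≤ k) (hkl : 2 * (k + 1) + 1 ≤ l) :
    (k + 1) ^ 2 * (15 * m) - (k + 1) * (1 * (15 * l * m) - 1) - (k + 2) * 1 + (k + 2) * ((109 : ℤ) ^ 0 - 0 * (15 * l * m)) ≤ (15 * m) := by
  have hα1 : (-15) * l + (0) ≤ 0 := by linarith
  have hs1 : (-15) * l + (1) ≤ 0 := by linarith
  have hαM : (-15) * l ^ 2 + (0) * l + (-45) ≤ 0 :=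
    InhBand.quad_nonpos_from (-15) (0) (-45) 5 l hl (by norm_num) (by norm_num) (by norm_num)
  have hsM : (-15) * l ^ 2 + (2) * l + (-47) ≤ 0 :=
    InhBand.quad_nonpos_from (-15) (2) (-47) 5 l hl (by norm_num) (by norm_num) (by norm_num)
  have hm0 : 0 ≤ m - 1 := by linarith
  have h1 : (15 * m) + (((109 : ℤ) ^ 0 - 0 * (15 * l * m)) - (1 * (15 * l * m) - 1) - 1) + (((109 : ℤ) ^ 0 - 0 * (15 * l * m)) - 1 - (15 * m)) ≤ 0 := by
    have hid : (15 * m) + (((109 : ℤ) ^ 0 - 0 * (15 * l * m)) - (1 * (15 * l * m) - 1) - 1) + (((109 : ℤ) ^ 0 - 0 * (15 * l * m)) - 1 - (15 * m)) = m * ((-15) * l + (0)) + ((0) * l + (1)) := by ring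
    rw [hid]; nlinarith [mul_nonpos_iff.mpr (Or.inl ⟨hm0, hα1⟩)]
  have hM : (15 * m) * (l - 1) ^ 2 + 2 * (((109 : ℤ) ^ 0 - 0 * (15 * l * m)) - (1 * (15 * l * m) - 1) - 1) * (l - 1) + 4 * (((109 : ℤ) ^ 0 - 0 * (15 * l * m)) - 1 - (15 * m)) ≤ 0 := by
    have hid : (15 * m) * (l - 1) ^ 2 + 2 * (((109 : ℤ) ^ 0 - 0 * (15 * l * m)) - (1 * (15 * l * m) - 1) - 1) * (l - 1) + 4 * (((109 : ℤ) ^ 0 - 0 * (15 * l * m)) - 1 - (15 * m)) =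
        m * ((-15) * l ^ 2 + (0) * l + (-45)) + ((0) * l ^ 2 + (2) * l + (-2)) := by ring
    rw [hid]; nlinarith [mul_nonpos_iff.mpr (Or.inl ⟨hm0, hαM⟩)]
  have hA : 0 ≤ (15 * m) := by positivity
  have h := InhBand.quad_nonpos_of_ends (15 * m) (((109 : ℤ) ^ 0 - 0 * (15 * l * m)) - (1 * (15 * l * m) - 1) - 1) (((109 : ℤ) ^ 0 - 0 * (15 * l * m)) - 1 - (15 * m)) (k + 1) l hA (by linarith) (by linarith) hkl h1 hM
  linarith [h]

/-- **Cells over `109` for `reyssat`, EVERY level `l ≥ 5`, every `e = 15·l·m` (`m ≥ 1`), every label `j = k + 1 ≤ (l−1)/2`**: the socket's integer cell `e·⌊(j²P − j·D − (j+1)·ρin)/e⌋ + (j+1)·ρout ≤ P` with `P = e·2/(2l) = 15·m`, `D = e − 1`, `ρin = 1`, `ρout = min(109^0 − 0e, 109^1 − 1e)` (floor dropped, then `InhBand.poly_reyssat_p109`). [folklore] -/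
theorem InhBand.cell_reyssat_p109 {l m : ℕ} (hl : 5 ≤ l) (hm : 1 ≤ m) (k : ℕ) (hk : k < (l - 1) / 2) :
    ((15 * l * m : ℕ) : ℤ) *
          (((((k + 1 : ℕ) : ℤ) ^ 2 * ((15 * l * m * 2 / (2 * l) : ℕ) : ℤ) - ((k + 1 : ℕ) : ℤ) * ((15 * l * m - 1 : ℕ) : ℤ) -
              ((k + 2 : ℕ) : ℤ) * (1 : ℤ))) / ((15 * l * m : ℕ) : ℤ)) +
        ((k + 2 : ℕ) : ℤ) * min ((109 : ℤ) ^ 0 - 0 * ((15 * l * m : ℕ) : ℤ)) ((109 : ℤ) ^ 1 - 1 * ((15 * l * m : ℕ) : ℤ)) ≤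
      ((15 * l * m * 2 / (2 * l) : ℕ) : ℤ) := by
  have hP : (15 * l * m * 2 / (2 * l) : ℕ) = 15 * m := by
    rw [show 15 * l * m * 2 = 2 * l * (15 * m) by ring]; exact Nat.mul_div_cancel_left _ (by omega)
  have he0 : (0 : ℤ) < ((15 * l * m : ℕ) : ℤ) := by positivity
  have hfloor := Int.mul_ediv_self_le (k := ((15 * l * m : ℕ) : ℤ))
    (x := (((k + 1 : ℕ) : ℤ) ^ 2 * ((15 * l * m * 2 / (2 * l) : ℕ) : ℤ) - ((k + 1 : ℕ) : ℤ) * ((15 * l * m - 1 : ℕ) : ℤ) -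
              ((k + 2 : ℕ) : ℤ) * (1 : ℤ))) he0.ne'
  have hl0 : 0 < l := by omega
  have hm0 : 0 < m := by omega
  have hsub : ((15 * l * m - 1 : ℕ) : ℤ) = 1 * ((15 * l * m : ℕ) : ℤ) - 1 := by
    rw [Nat.cast_sub (Nat.succ_le_of_lt (by positivity))]; push_cast; ring
  have hmin : min ((109 : ℤ) ^ 0 - 0 * ((15 * l * m : ℕ) : ℤ)) ((109 : ℤ) ^ 1 - 1 * ((15 * l * m : ℕ) : ℤ)) ≤ (109 : ℤ) ^ 0 - 0 * ((15 * l * m : ℕ) : ℤ) := min_le_left _ _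
  have hk2 : (0 : ℤ) ≤ ((k + 2 : ℕ) : ℤ) := by positivity
  have hmin' := mul_le_mul_of_nonneg_left hmin hk2
  have hkl : 2 * ((k : ℤ) + 1) + 1 ≤ (l : ℤ) := by
    have h1 : 2 * (k + 1) + 1 ≤ l := by omega
    exact_mod_cast h1
  have hpoly := InhBand.poly_reyssat_p109 (k : ℤ) (l : ℤ) (m : ℤ) (by exact_mod_cast hl) (by exact_mod_cast hm) (by positivity) hkl
  generalize hQ : ((((k + 1 : ℕ) : ℤ) ^ 2 * ((15 * l * m * 2 / (2 * l) : ℕ) : ℤ) - ((k + 1 : ℕ) : ℤ) * ((15 * l * m - 1 : ℕ) : ℤ) -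
              ((k + 2 : ℕ) : ℤ) * (1 : ℤ))) / ((15 * l * m : ℕ) : ℤ) = Q at hfloor ⊢
  rw [hP, hsub] at hfloor; rw [hP]
  push_cast at hfloor hmin' hpoly ⊢
  linarith [hfloor, hmin', hpoly]

end Summit.ABC.IUTFork.Conditional
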